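import Literature.Analysis.FluidPDE.AxisymmetricTypeIInfinityRRS
import Literature.Analysis.FluidPDE.AxisymmetricL3PressureBounds
import HarnessLib

/-!
# Boundedness near the final time outside a large ball — without a Type I assumption

Analysis/FluidPDE proofs-layer file on the discharge path of
`Literature.Analysis.FluidPDE.LeiZhang2011_regularity_bmoStream`: the far-field step of the
Type I programme (`AxisymmetricTypeIInfinity`, `AxisymmetricTypeIInfinityRRS`: the one-scale
ε-regularity criterion of Caffarelli–Kohn–Nirenberg, Prop. 1 / Cor. 1, in the unforced
`L³ × L^{3/2}` form of Lemarié-Rieusset's Thm. 14.4 — a theorem of the tree through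
Robinson–Rodrigo–Sadowski's Lemma 15.12, `RRS2016.lemma15_12_holds` — applied on far cylinders
`Q_{√T/2}(T, x)`) re-run for the standing hypotheses `AxisymmetricL3Hyp` (no Type I field). The
only change is the source of the smallness of `∫∫_Q |q|^{3/2}` on far cylinders: the gauged
pressure is in `L^{3/2}` of the final slab (`AxisymmetricL3PressureBounds`), so its tails over
`{|x| ≥ n}` are small (`exists_radius_tail_lt`), exactly as for `u ∈ L³`.

* `AxisymmetricL3Hyp.lintegral_strip_enorm_pow_three_lt_top`, `.exists_radius_cylinder_enorm_pow_three_lt`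
  — far field of `u ∈ L³` (as in the Type I file);
* `AxisymmetricL3Hyp.lintegral_strip_gauged_pressure_lt_top`, `.exists_radius_cylinder_gauged_pressure_lt`
  — far field of the gauged pressure;
* `axisymmetricL3_boundedNearTop_infinity_of_zeroForce`, `axisymmetricL3_boundedNearTop_infinity` —
  there are `R`, `r > 0`, `K` with `‖u t x‖ ≤ K` for `T − r² < t < T`, `‖x‖ ≥ R`.

## References

* P. G. Lemarié-Rieusset, *The Navier–Stokes Problem in the 21st Century*, CRC Press 2016,
  Thm. 14.4 (p. 505), case `f = 0`. [LemarieRieusset2016]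
* J. C. Robinson, J. L. Rodrigo, W. Sadowski, *The three-dimensional Navier–Stokes equations*,
  CUP 2016, Lemma 15.12 and Thm. 15.3. [RobinsonRodrigoSadowski2016]
* L. Caffarelli, R. Kohn, L. Nirenberg, Comm. Pure Appl. Math. 35 (1982), Prop. 1, Cor. 1.
  [CaffarelliKohnNirenberg1982]
-/

noncomputable section

open MeasureTheory Set Function Filter Topology TopologicalSpace Metric
open scoped NNReal ENNReal InnerProductSpace RealInnerProductSpace

namespace Literature.Analysis.FluidPDE

/-- Local notation for physical space `ℝ³ = EuclideanSpace ℝ (Fin 3)`. -/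
local notation "ℝ³" => EuclideanSpace ℝ (Fin 3)

namespace AxisymmetricL3Hyp

variable {ν T : ℝ} {u : ℝ → ℝ³ → ℝ³} {p : ℝ → ℝ³ → ℝ}

/-! ### The far field of `u ∈ L³` -/

/-- `u ∈ L³` of every final strip `(a, T) × ℝ³`, `0 ≤ a`. [folklore] -/
theorem lintegral_strip_enorm_pow_three_lt_top (H : AxisymmetricL3Hyp ν T u p) {a : ℝ}
    (ha : 0 ≤ a) :
    ∫⁻ z in Ioo a T ×ˢ (univ : Set ℝ³), ‖u z.1 z.2‖ₑ ^ (3 : ℕ) < ∞ := by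
  calc ∫⁻ z in Ioo a T ×ˢ (univ : Set ℝ³), ‖u z.1 z.2‖ₑ ^ (3 : ℕ)
      = ∫⁻ z, ‖u z.1 z.2‖ₑ ^ (3 : ℕ) ∂((volume.restrict (Ioo a T)).prod (volume : Measure ℝ³)) := by
        rw [Measure.restrict_prod_eq_prod_univ, ← Measure.volume_eq_prod]
    _ ≤ ∫⁻ t in Ioo a T, ∫⁻ x, ‖u t x‖ₑ ^ (3 : ℕ) := lintegral_prod_le _
    _ ≤ ∫⁻ t in Ioo 0 T, ∫⁻ x, ‖u t x‖ₑ ^ (3 : ℕ) := lintegral_mono_set (Ioo_subset_Ioo_left ha)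
    _ < ∞ := H.lintegral_Ioo_lintegral_enorm_pow_three_lt_top

/-- **Small `L³` mass on far cylinders**: for `r² ≤ T` and `η > 0` there is `n` with
`∫∫_{Q_r(T, x₀)} |u|³ < η` whenever `|x₀| ≥ n + r`. [folklore] -/
theorem exists_radius_cylinder_enorm_pow_three_lt (H : AxisymmetricL3Hyp ν T u p) {r : ℝ}
    (hrT : r ^ 2 ≤ T) {η : ℝ≥0∞} (hη : 0 < η) :
    ∃ n : ℕ, ∀ x₀ : ℝ³, (n : ℝ) + r ≤ ‖x₀‖ →
      ∫⁻ z in parabolicCylinder r ((T : ℝ), x₀), ‖u z.1 z.2‖ₑ ^ (3 : ℕ) < η := by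
  have hfin := H.lintegral_strip_enorm_pow_three_lt_top (a := T - r ^ 2) (by linarith)
  obtain ⟨n, hn⟩ := exists_radius_tail_lt hfin hη
  refine ⟨n, fun x₀ hx₀ => lt_of_le_of_lt (lintegral_mono_set ?_) hn⟩
  intro z hz
  rw [mem_parabolicCylinder] at hz
  refine ⟨⟨hz.1, mem_univ _⟩, ?_⟩
  show (n : ℝ) ≤ ‖z.2‖
  have h1 : ‖x₀‖ ≤ ‖z.2‖ + dist z.2 x₀ := by
    have := norm_le_norm_add_norm_sub' x₀ z.2
    rwa [← dist_eq_norm, dist_comm] at this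
  linarith [hz.2]

/-! ### The far field of the gauged pressure -/

/-- **The gauged pressure is in `L^{3/2}` of every final strip** `(a, T) × ℝ³`, `0 ≤ a`
(Tonelli over the jointly measurable `q`, and `p̃[u] ∈ L^{3/2}` of the slab). [folklore] -/
theorem lintegral_strip_gauged_pressure_lt_top (H : AxisymmetricL3Hyp ν T u p)
    {q : ℝ → ℝ³ → ℝ} (hq : ∀ᵐ t ∂(volume.restrict (Ioo 0 T)), q t = normalisedPressure (u t))
    (hqm : AEStronglyMeasurable (uncurry q)
      ((volume : Measure (ℝ × ℝ³)).restrict (Ioo 0 T ×ˢ univ)))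
    {a : ℝ} (ha : 0 ≤ a) :
    ∫⁻ z in Ioo a T ×ˢ (univ : Set ℝ³), ‖q z.1 z.2‖ₑ ^ (3 / 2 : ℝ) < ∞ := by
  have hsub : Ioo a T ×ˢ (univ : Set ℝ³) ⊆ Ioo 0 T ×ˢ univ :=
    prod_mono (Ioo_subset_Ioo_left ha) Subset.rfl
  refine lt_of_le_of_lt (lintegral_mono_set hsub) ?_
  have hm : AEMeasurable (fun z : ℝ × ℝ³ => ‖q z.1 z.2‖ₑ ^ (3 / 2 : ℝ))
      ((volume.restrict (Ioo 0 T)).prod (volume : Measure ℝ³)) := by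
    have e : (volume.restrict (Ioo 0 T)).prod (volume : Measure ℝ³) =
        (volume : Measure (ℝ × ℝ³)).restrict (Ioo 0 T ×ˢ univ) := by
      rw [Measure.volume_eq_prod, Measure.restrict_prod_eq_prod_univ]
    rw [e]
    exact (hqm.aemeasurable.enorm.pow_const _)
  calc ∫⁻ z in Ioo 0 T ×ˢ (univ : Set ℝ³), ‖q z.1 z.2‖ₑ ^ (3 / 2 : ℝ)
      = ∫⁻ z, ‖q z.1 z.2‖ₑ ^ (3 / 2 : ℝ) ∂((volume.restrict (Ioo 0 T)).prod (volume : Measure ℝ³)) := by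
        rw [Measure.restrict_prod_eq_prod_univ, ← Measure.volume_eq_prod]
    _ = ∫⁻ t in Ioo 0 T, ∫⁻ x, ‖q t x‖ₑ ^ (3 / 2 : ℝ) := lintegral_prod _ hm
    _ = ∫⁻ t in Ioo 0 T, ∫⁻ x in (univ : Set ℝ³), ‖q t x‖ₑ ^ (3 / 2 : ℝ) := by
        simp only [Measure.restrict_univ]
    _ < ∞ := H.lintegral_Ioo_setLIntegral_gauged_pressure_lt_top hq le_rfl univ

/-- **Small `L^{3/2}` mass of the gauged pressure on far cylinders**: for `r² ≤ T` and `η > 0`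
there is `n` with `∫∫_{Q_r(T, x₀)} |q|^{3/2} < η` whenever `|x₀| ≥ n + r`. [folklore] -/
theorem exists_radius_cylinder_gauged_pressure_lt (H : AxisymmetricL3Hyp ν T u p)
    {q : ℝ → ℝ³ → ℝ} (hq : ∀ᵐ t ∂(volume.restrict (Ioo 0 T)), q t = normalisedPressure (u t))
    (hqm : AEStronglyMeasurable (uncurry q)
      ((volume : Measure (ℝ × ℝ³)).restrict (Ioo 0 T ×ˢ univ)))
    {r : ℝ} (hrT : r ^ 2 ≤ T) {η : ℝ≥0∞} (hη : 0 < η) :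
    ∃ n : ℕ, ∀ x₀ : ℝ³, (n : ℝ) + r ≤ ‖x₀‖ →
      ∫⁻ z in parabolicCylinder r ((T : ℝ), x₀), ‖q z.1 z.2‖ₑ ^ (3 / 2 : ℝ) < η := by
  have hfin := H.lintegral_strip_gauged_pressure_lt_top hq hqm (a := T - r ^ 2) (by linarith)
  obtain ⟨n, hn⟩ := exists_radius_tail_lt hfin hη
  refine ⟨n, fun x₀ hx₀ => lt_of_le_of_lt (lintegral_mono_set ?_) hn⟩
  intro z hz
  rw [mem_parabolicCylinder] at hz
  refine ⟨⟨hz.1, mem_univ _⟩, ?_⟩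
  show (n : ℝ) ≤ ‖z.2‖
  have h1 : ‖x₀‖ ≤ ‖z.2‖ + dist z.2 x₀ := by
    have := norm_le_norm_add_norm_sub' x₀ z.2
    rwa [← dist_eq_norm, dist_comm] at this
  linarith [hz.2]

end AxisymmetricL3Hyp

/-! ### Boundedness at spatial infinity -/

/-- **Boundedness near the final time outside a large ball, without a Type I assumption — from
the unforced one-scale ε-regularity criterion** (proof of
`typeI_boundedNearTop_infinity_of_zeroForce`, with the far field of the gauged pressure from its
`L^{3/2}` integrability on the final slab). [cite: LemarieRieusset2016, Thm. 14.4 p. 505, case f = 0] -/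
theorem axisymmetricL3_boundedNearTop_infinity_of_zeroForce
    (h0 : ∀ ν : ℝ, 0 < ν → ∃ ε₀ C₀ : ℝ, 0 < ε₀ ∧ 0 < C₀ ∧
      ∀ (Ω : Opens (ℝ × EuclideanSpace ℝ (Fin 3)))
        (u : ℝ → EuclideanSpace ℝ (Fin 3) → EuclideanSpace ℝ (Fin 3))
        (p : ℝ → EuclideanSpace ℝ (Fin 3) → ℝ)
        (G : ℝ → EuclideanSpace ℝ (Fin 3) →
          EuclideanSpace ℝ (Fin 3) →L[ℝ] EuclideanSpace ℝ (Fin 3)),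
        IsLRSuitableWeakSolutionOn Ω ν 3 0 u p G →
        ∀ (z₀ : ℝ × EuclideanSpace ℝ (Fin 3)) (r₀ l : ℝ), 0 < r₀ →
          parabolicCylinder r₀ z₀ ⊆ (Ω : Set (ℝ × EuclideanSpace ℝ (Fin 3))) →
          0 ≤ l → l ≤ ε₀ →
          ∫⁻ w in parabolicCylinder r₀ z₀,
              (‖u w.1 w.2‖ₑ ^ (3 : ℕ) + ‖p w.1 w.2‖ₑ ^ (3 / 2 : ℝ)) ≤
            ENNReal.ofReal (l ^ 3 * r₀ ^ 2) →
          ∀ᵐ w ∂(volume.restrict (parabolicCylinder (r₀ / 2) z₀)),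
            ‖u w.1 w.2‖ ≤ C₀ * l / r₀)
    {ν T : ℝ} {u : ℝ → EuclideanSpace ℝ (Fin 3) → EuclideanSpace ℝ (Fin 3)}
    {p : ℝ → EuclideanSpace ℝ (Fin 3) → ℝ} (H : AxisymmetricL3Hyp ν T u p) :
    ∃ R r K : ℝ, 0 < r ∧ ∀ t ∈ Ioo (T - r ^ 2) T, ∀ x : EuclideanSpace ℝ (Fin 3),
      R ≤ ‖x‖ → ‖u t x‖ ≤ K := by
  have hν := H.viscosity_pos
  have hT := H.time_pos
  obtain ⟨ε₀, C₀, hε₀, hC₀, hcrit⟩ := h0 ν hν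
  -- the scale
  set r₀ : ℝ := Real.sqrt T / 2 with hr₀
  have hr₀pos : 0 < r₀ := by positivity
  have hr₀T : r₀ ^ 2 ≤ T := by
    rw [hr₀, div_pow, Real.sq_sqrt hT.le]; linarith
  -- the smallness budget
  set η : ℝ≥0∞ := ENNReal.ofReal (ε₀ ^ 3 * r₀ ^ 2) / 2 with hη
  have hηpos : 0 < η := ENNReal.half_pos (ENNReal.ofReal_pos.2 (by positivity)).ne'
  -- the gauged pressure
  obtain ⟨q, hsuit, hqae, hqm⟩ := H.exists_gauged_pressure
  -- far field of `u`
  obtain ⟨n₁, hn₁⟩ := H.exists_radius_cylinder_enorm_pow_three_lt hr₀T hηpos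
  -- far field of `q`
  obtain ⟨n₂, hn₂⟩ := H.exists_radius_cylinder_gauged_pressure_lt hqae hqm hr₀T hηpos
  -- the square-integrable weak gradient of the Leray–Hopf solution on the slab
  obtain ⟨G', hG'slab, -, hG'int, -⟩ := H.lerayHopf.exists_hasWeakSpatialGradientOn
  -- conclusion
  refine ⟨max (n₁ : ℝ) n₂ + r₀, r₀ / 2, C₀ * ε₀ / r₀, by positivity, fun t ht x hx => ?_⟩
  -- the cylinder about `(T, x)`
  set Q : Opens (ℝ × EuclideanSpace ℝ (Fin 3)) := parabolicCylinderOpens r₀ ((T : ℝ), x)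
    with hQdef
  have hQ : (Q : Set (ℝ × EuclideanSpace ℝ (Fin 3))) = parabolicCylinder r₀ ((T : ℝ), x) := rfl
  have hQslab : (Q : Set (ℝ × EuclideanSpace ℝ (Fin 3))) ⊆
      Ioo 0 T ×ˢ (univ : Set (EuclideanSpace ℝ (Fin 3))) := by
    intro z hz
    rw [hQ, mem_parabolicCylinder] at hz
    exact ⟨⟨by nlinarith [hz.1.1], hz.1.2⟩, mem_univ _⟩
  have hQle : Q ≤ slab (EuclideanSpace ℝ (Fin 3)) (Ioo 0 T) isOpen_Ioo := fun z hz => by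
    rw [mem_slab]; exact (hQslab hz).1
  have hsws := hsuit Q hQslab
  obtain ⟨G₀, hG₀, -, hloc⟩ := hsws.localEnergy
  -- `∫_Q |G₀|² < ∞` through the Leray–Hopf gradient
  have hG₀int : ∫⁻ w in (Q : Set (ℝ × EuclideanSpace ℝ (Fin 3))),
      ENNReal.ofReal (frobeniusNormSq (G₀ w.1 w.2)) < ∞ := by
    have hae : ∀ᵐ w ∂(volume.restrict (Q : Set (ℝ × EuclideanSpace ℝ (Fin 3)))),
        ENNReal.ofReal (frobeniusNormSq (G₀ w.1 w.2)) =
          ENNReal.ofReal (frobeniusNormSq (G' w.1 w.2)) := by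
      filter_upwards [hG₀.ae_eq (hG'slab.mono hQle)] with w hw
      change ENNReal.ofReal (frobeniusNormSq (uncurry G₀ w)) =
        ENNReal.ofReal (frobeniusNormSq (uncurry G' w))
      rw [hw]
    rw [lintegral_congr_ae hae]
    refine lt_of_le_of_lt (lintegral_mono_set ?_) hG'int
    rw [hQ]
    exact hQslab
  -- the energy class in indicator form
  set CE : ℝ≥0 := Real.toNNReal (2 * VectorCalculus.kineticEnergy (u 0)) with hCE
  have hCEind : ∀ᵐ s : ℝ, ∫⁻ y, (Q : Set (ℝ × EuclideanSpace ℝ (Fin 3))).indicator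
      (fun w : ℝ × EuclideanSpace ℝ (Fin 3) => ‖u w.1 w.2‖ₑ ^ 2) (s, y) ≤ CE := by
    rw [hQ, parabolicCylinder]
    refine ae_lintegral_indicator_prod_le measurableSet_ball (ae_of_all _ fun s hs => ?_)
    have hsI : s ∈ Ico 0 T := ⟨by nlinarith [hs.1], hs.2⟩
    calc ∫⁻ y in ball x r₀, ‖u s y‖ₑ ^ 2 ≤ eEnergy (u s) := setLIntegral_le_lintegral _ _
      _ ≤ ENNReal.ofReal (2 * VectorCalculus.kineticEnergy (u 0)) := H.eEnergy_le hsI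
      _ = CE := rfl
  have hp' : ∫⁻ w in (Q : Set (ℝ × EuclideanSpace ℝ (Fin 3))),
      ‖q w.1 w.2‖ₑ ^ (3 / 2 : ℝ) < ∞ := by
    rw [hQ]; exact H.lintegral_cylinder_gauged_pressure_lt_top hqae hr₀T x
  -- the zero force
  have hfq : MemLp (uncurry (0 : ℝ → EuclideanSpace ℝ (Fin 3) → EuclideanSpace ℝ (Fin 3)))
      (ENNReal.ofReal 3) (volume.restrict (Q : Set (ℝ × EuclideanSpace ℝ (Fin 3)))) :=
    (MemLp.zero : MemLp (0 : ℝ × EuclideanSpace ℝ (Fin 3) → EuclideanSpace ℝ (Fin 3))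
      (ENNReal.ofReal 3) (volume.restrict (Q : Set (ℝ × EuclideanSpace ℝ (Fin 3)))))
  -- the standing hypotheses of §14.3 on `Q`, force `0`, exponent `3`
  have hLR : IsLRSuitableWeakSolutionOn Q ν 3 0 u q G₀ :=
    ⟨by rw [hQ]; exact isConnected_parabolicCylinder hr₀pos _, ⟨CE, hCEind⟩, hG₀, hG₀int, hp',
      hfq, hsws.distributional, hloc⟩
  -- smallness on the far cylinder `Q_{r₀}(T, x)`, `|x| ≥ max n₁ n₂ + r₀`
  have hx₁ : (n₁ : ℝ) + r₀ ≤ ‖x‖ := by linarith [le_max_left (n₁ : ℝ) n₂]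
  have hx₂ : (n₂ : ℝ) + r₀ ≤ ‖x‖ := by linarith [le_max_right (n₁ : ℝ) n₂]
  have hmeas_u : AEMeasurable (fun w : ℝ × EuclideanSpace ℝ (Fin 3) => ‖u w.1 w.2‖ₑ ^ (3 : ℕ))
      (volume.restrict (parabolicCylinder r₀ ((T : ℝ), x))) := by
    have h1 : AEStronglyMeasurable (uncurry u)
        (volume.restrict (parabolicCylinder r₀ ((T : ℝ), x))) :=
      hsws.distributional.1.aestronglyMeasurable
    exact (h1.aemeasurable.enorm.pow_const 3)
  have hint : ∫⁻ w in parabolicCylinder r₀ ((T : ℝ), x),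
      (‖u w.1 w.2‖ₑ ^ (3 : ℕ) + ‖q w.1 w.2‖ₑ ^ (3 / 2 : ℝ)) ≤ ENNReal.ofReal (ε₀ ^ 3 * r₀ ^ 2) := by
    rw [lintegral_add_left' hmeas_u]
    have hu3 : ∫⁻ w in parabolicCylinder r₀ ((T : ℝ), x), ‖u w.1 w.2‖ₑ ^ (3 : ℕ) ≤ η :=
      (hn₁ x hx₁).le
    have hq32 : ∫⁻ w in parabolicCylinder r₀ ((T : ℝ), x), ‖q w.1 w.2‖ₑ ^ (3 / 2 : ℝ) ≤ η :=
      (hn₂ x hx₂).le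
    calc (∫⁻ w in parabolicCylinder r₀ ((T : ℝ), x), ‖u w.1 w.2‖ₑ ^ (3 : ℕ)) +
          ∫⁻ w in parabolicCylinder r₀ ((T : ℝ), x), ‖q w.1 w.2‖ₑ ^ (3 / 2 : ℝ)
        ≤ η + η := add_le_add hu3 hq32
      _ = ENNReal.ofReal (ε₀ ^ 3 * r₀ ^ 2) := ENNReal.add_halves _
  -- the criterion
  have hbdd := hcrit Q u q G₀ hLR ((T : ℝ), x) r₀ ε₀ hr₀pos (by rw [hQ]) hε₀.le le_rfl hint
  -- everywhere on `Q_{r₀/2}(T, x)` by continuity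
  have hUopen : IsOpen (parabolicCylinder (r₀ / 2) ((T : ℝ), x)) := isOpen_parabolicCylinder _ _
  have hUslab : parabolicCylinder (r₀ / 2) ((T : ℝ), x) ⊆
      Ioo 0 T ×ˢ (univ : Set (EuclideanSpace ℝ (Fin 3))) := by
    intro z hz
    rw [mem_parabolicCylinder] at hz
    exact ⟨⟨by nlinarith [hz.1.1], hz.1.2⟩, mem_univ _⟩
  have hcont : ContinuousOn (fun z : ℝ × EuclideanSpace ℝ (Fin 3) => u z.1 z.2)
      (parabolicCylinder (r₀ / 2) ((T : ℝ), x)) :=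
    H.classical_Ioo.smooth_velocity.continuousOn.mono hUslab
  have hall := SereginSverak2009.forall_le_of_ae_le_of_continuousOn hUopen hcont.norm
    continuousOn_const hbdd
  have hmem : ((t, x) : ℝ × EuclideanSpace ℝ (Fin 3)) ∈
      parabolicCylinder (r₀ / 2) ((T : ℝ), x) := by
    rw [mem_parabolicCylinder]
    exact ⟨ht, by simp only [dist_self]; positivity⟩
  have := hall (t, x) hmem
  simpa only [mul_div_assoc] using this


/-- **Boundedness near the final time outside a large ball, without a Type I assumption.**
Under `AxisymmetricL3Hyp ν T u p` there are `R`, `r > 0`, `K` with `‖u t x‖ ≤ K` for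
`T − r² < t < T` and `‖x‖ ≥ R` (with the tree's theorem `RRS2016.lemma15_12_holds` through
`lemarieRieusset_epsilon_regularity_zeroForce_of_lemma15_12`).
[cite: LemarieRieusset2016, Thm. 14.4 p. 505, case f = 0; RobinsonRodrigoSadowski2016, Lemma 15.12; CaffarelliKohnNirenberg1982, Prop. 1 and Cor. 1] -/
theorem axisymmetricL3_boundedNearTop_infinity {ν T : ℝ} {u : ℝ → ℝ³ → ℝ³} {p : ℝ → ℝ³ → ℝ}
    (H : AxisymmetricL3Hyp ν T u p) :
    ∃ R r K : ℝ, 0 < r ∧ ∀ t ∈ Ioo (T - r ^ 2) T, ∀ x : ℝ³, R ≤ ‖x‖ → ‖u t x‖ ≤ K :=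
  axisymmetricL3_boundedNearTop_infinity_of_zeroForce (fun _ hν =>
    lemarieRieusset_epsilon_regularity_zeroForce_of_lemma15_12 RRS2016.lemma15_12_holds hν
      (by norm_num)) H

end Literature.Analysis.FluidPDE

end
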